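import Literature.Probability.RandomPlanarGeometry.SAWTriangularFiniteMemory
import HarnessLib

/-!
# `μ(𝕋) ≤ 4.281`: the memory-11 Pönitz–Tittmann certificate on the triangular lattice (one `native_decide`)

Topic `Literature/Probability/RandomPlanarGeometry`. One compiled evaluation of
`TriFiniteMemory.check 11 4281 1000 60` (`SAWTriangularFiniteMemory.lean`): the breadth-first search finds the
`293 767` states of the memory-11 automaton on `𝕋` (self-avoiding six-letter step words `a` with
`|a| + dist_𝕋(0, end a) ≤ 11`), 60 rounds of integer power iteration propose a weight vector, and the verified
checker confirms closure and the Collatz–Wielandt inequalities with ratio `4281/1000` (the Perron root is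
`4.280715…`; memory `9`/`10` would give `4.308899…`/`4.293412…`). By `exp_logMuTri_le_of_check` this proves
**`μ(𝕋) = exp logMuTri ≤ 4.281`**; with the tree's lower bound `(3+√17)/2 ≤ μ(𝕋)` (`SAWTriangularWindow.lean`) the
kernel window becomes `[3.5615, 4.281]`.

Status in print (lane «pcv-sawmu», lit-2 g12 cell): this is the first KERNEL-CERTIFIED upper bound for the
triangular-lattice connective constant (standard axioms + the `native_decide` axiom `Lean.ofReduceBool`,
computational class) and the first finite-memory (Pönitz–Tittmann-type) automaton bound written for `𝕋` —
Pönitz–Tittmann (2000) treat `ℤ^d` only; it is WEAKER in value than the printed (computer-assisted, uncertified)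
bounds, which use Alm's eigenvalue method: Alm 1993 `μ(𝕋) < 4.277799` (SECONDARY-SOURCE numeral: Alm 1993 is not
held by the lane — acq-10162 — and the value is quoted from secondary sources, unverified against the 1993 page),
Alm 2005 §5.5.1 `μ(𝕋) < 4.251419` (`G(8,20)`, dimension `18 678`); numerically `μ(𝕋) ≈ 4.150797` (Jensen 2004). In the
tree: the symmetry-reduced memory-12 certificate `SAWTriangularFiniteMemory12.lean` improves the value to `4.271`
(`exp_logMuTri_le_4271`); a memory-13 certificate (`≈ 4.262`) is ANNOUNCED ONLY — sized by the lane (1 178 071 `D₆`-classes,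
Perron root `4.26111`) but NOT certified and not in the tree.

## References

* A. Pönitz, P. Tittmann, *Improved upper bounds for self-avoiding walks in ℤᵈ*, Electron. J. Combin. 7 (2000)
  R21, §2–§3, Table 2 (`ℤ^d` only) [PonitzTittmann2000].
* S. E. Alm, *Upper and lower bounds for the connective constants of self-avoiding walks on the Archimedean and
  Laves lattices*, J. Phys. A 38 (2005) 2055–2080, §4 Theorem 2 and §5.5.1 [Alm2005].
* I. Jensen, *Improved lower bounds on the connective constants for two-dimensional self-avoiding walks*,
  J. Phys. A 37 (2004) 11521–11529, §2 [Jensen2004SAWBounds].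
-/

namespace Literature.Probability.RandomPlanarGeometry.SAW

/-- The memory-11 certificate on `𝕋` evaluates to `true` (`293 767` states, ratio `4281/1000`).
[cite: PonitzTittmann2000, §3 Table 2 (method; ℤ^d only)] -/
theorem TriFiniteMemory.check_11 : TriFiniteMemory.check 11 4281 1000 60 = true := by
  native_decide

/-- **`μ(𝕋) ≤ 4.281`**: `exp logMuTri ≤ 4.281` (first kernel-certified upper bound for the triangular
lattice; print: Alm 2005, `μ(𝕋) < 4.251419`, uncertified). [cite: Alm2005, §5.5.1] -/
theorem exp_logMuTri_le_4281 : Real.exp logMuTri ≤ 4.281 := by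
  have h := TriFiniteMemory.exp_logMuTri_le_of_check TriFiniteMemory.check_11 (by norm_num)
  have e : ((4281 : ℕ) : ℝ) / ((1000 : ℕ) : ℝ) = 4.281 := by norm_num
  rwa [e] at h

/-- The same bound in the `ℕ`-ratio form `exp logMuTri ≤ 4281/1000` (the lane's certificate shape
`TriMuUpperCert 4281 1000`). [cite: Alm2005, §5.5.1] -/
theorem exp_logMuTri_le_div_11 : Real.exp logMuTri ≤ ((4281 : ℕ) : ℝ) / ((1000 : ℕ) : ℝ) :=
  TriFiniteMemory.exp_logMuTri_le_of_check TriFiniteMemory.check_11 (by norm_num)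

/-- Log-scale form: `logMuTri ≤ log 4.281`. [cite: Alm2005, §5.5.1] -/
theorem logMuTri_le_log_4281 : logMuTri ≤ Real.log 4.281 := by
  have h := TriFiniteMemory.logMuTri_le_log_div_of_check TriFiniteMemory.check_11 (by norm_num)
  have e : ((4281 : ℕ) : ℝ) / ((1000 : ℕ) : ℝ) = 4.281 := by norm_num
  rwa [e] at h

/-- Log-scale `ℕ`-ratio form (the lane's REPORT shape): `logMuTri ≤ log ((4281 : ℕ)/(1000 : ℕ))`.
[cite: Alm2005, §5.5.1] -/
theorem logMuTri_le_log_div_11 : logMuTri ≤ Real.log (((4281 : ℕ) : ℝ) / ((1000 : ℕ) : ℝ)) := by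
  have h := exp_logMuTri_le_div_11
  calc logMuTri = Real.log (Real.exp logMuTri) := (Real.log_exp logMuTri).symm
    _ ≤ Real.log (((4281 : ℕ) : ℝ) / ((1000 : ℕ) : ℝ)) := Real.log_le_log (Real.exp_pos _) h

/-- **The kernel window for `μ(𝕋)` after this file: `(3+√17)/2 ≤ exp logMuTri ≤ 4.281`.**
[cite: Alm2005, §5.5.1] -/
theorem muTri_window_4281 : (3 + Real.sqrt 17) / 2 ≤ Real.exp logMuTri ∧ Real.exp logMuTri ≤ 4.281 :=
  ⟨muTri_window.1, exp_logMuTri_le_4281⟩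

end Literature.Probability.RandomPlanarGeometry.SAW
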